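import Literature.NumberTheory.LFunctions.EquivalentsKeiperLiProofs
import Literature.NumberTheory.LFunctions.ZetaZeroReciprocalSum
import Literature.NumberTheory.LFunctions.BombieriLagariasZeroLocation
import HarnessLib

/-!
# The Keiper–Li coefficients as an absolutely convergent sum over the zeros, and `Re ρ ≥ ½ ⇒ RH`

Topic `Literature/NumberTheory/LFunctions`.  Everything PROVED; no definitions.

Li (1997, (1.4)) and Bombieri–Lagarias (1999, (1.2)–(1.3)) write `λ_n = Σ*_ρ [1 − (1 − 1/ρ)ⁿ]` over the
non-trivial zeros of `ζ`, the `*`-sum being `lim_{T→∞} Σ_{|Im ρ| ≤ T}` (the tree's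
`keiperLiCoeff_eq_zero_sum_holds`).  Since `Σ_ρ m(ρ)(1 + |Re(1−ρ̄)|)/(1 + |1−ρ̄|)² < ∞`
(`Σ m(ρ)/(1+γ²) < ∞`, `ZetaZeroSum.summable_zeroOrder_div_one_add_sq`), the real family
`ρ ↦ m(ρ) Re[1 − (1 − 1/ρ)ⁿ]` is absolutely summable (`BombieriLagarias.summable_term_pos`) and the
`*`-sum is an honest `tsum` over the subtype of non-trivial zeros:

* `summable_weight_zetaZeros` — Bombieri–Lagarias' hypothesis for the reflected family `1 − ρ̄` of the
  non-trivial zeros of `ζ` with their multiplicities;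
* `keiperLiCoeff_eq_tsum_zeros` — `λ_n = Σ' ρ, m(ρ) Re[1 − (1 − 1/ρ)ⁿ]` (`n ≥ 1`);
* `riemannHypothesis_of_forall_half_le_re` — if every non-trivial zero has `Re ρ ≥ ½` then RH (symmetry
  `ρ ↦ 1 − ρ̄`);
* `riemannHypothesis_iff_forall_tsum_nonneg` — Li's criterion in the family form
  (`bombieriLagarias1999_theorem1_pos` for this family).

These are the bookkeeping steps behind "λ_n bounded below ⇒ RH" (Bombieri–Lagarias Thm. 1 (c) ⇒ (a)).

## References
* X.-J. Li, J. Number Theory 65 (1997), (1.4). [Li1997]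
* E. Bombieri, J. C. Lagarias, J. Number Theory 77 (1999), Thm. 1, (1.2)–(1.3). [BombieriLagarias1999]
* X.-J. Li, Illinois J. Math. 48 (2004), Thm. 2 and p. 494. [Li2004]
-/

noncomputable section

open Complex Filter Topology Set
open scoped ComplexConjugate

namespace Literature.NumberTheory.LFunctions

open BombieriLagarias ZetaZeros

/-- Multiplicity of a non-trivial zero as a natural number. [folklore] -/
private theorem toNat_cast_eq (ρ : ZetaZeros.riemannZetaNontrivialZeros) :
    (((riemannZetaZeroOrder (ρ : ℂ)).toNat : ℕ) : ℝ) = (riemannZetaZeroOrder (ρ : ℂ) : ℝ) := by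
  have h := riemannZetaNontrivialZeros.one_le_order ρ.2
  have : ((riemannZetaZeroOrder (ρ : ℂ)).toNat : ℤ) = riemannZetaZeroOrder (ρ : ℂ) := Int.toNat_of_nonneg (by omega)
  exact_mod_cast this

/-- Non-trivial zeros are `≠ 0`. [folklore] -/
private theorem ne_zero_of_mem' (ρ : ZetaZeros.riemannZetaNontrivialZeros) : (ρ : ℂ) ≠ 0 := by
  intro h
  have := riemannZetaNontrivialZeros.re_pos ρ.2
  rw [h] at this
  simp at this

/-- **Bombieri–Lagarias' hypothesis for the zeros of `ζ`**: the reflected family `1 − ρ̄` of the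
non-trivial zeros, with multiplicities, has `Σ m(ρ)(1 + |Re(1−ρ̄)|)/(1+|1−ρ̄|)² ≤ 2 Σ m(ρ)/(1+γ²) < ∞`.
[cite: Li2004, Theorem 2 and p. 494] -/
theorem summable_weight_zetaZeros :
    Summable (weight (fun ρ : ZetaZeros.riemannZetaNontrivialZeros ↦ 1 - conj (ρ : ℂ))
      (fun ρ ↦ (riemannZetaZeroOrder (ρ : ℂ)).toNat)) := by
  refine Summable.of_nonneg_of_le (fun ρ ↦ weight_nonneg _ _ ρ) (fun ρ ↦ ?_)
    (ZetaZeroSum.summable_zeroOrder_div_one_add_sq.mul_left 2)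
  have hm0 : (0 : ℝ) ≤ riemannZetaZeroOrder (ρ : ℂ) := ZetaZeroSum.zeroOrder_nonneg ρ
  have h0 := riemannZetaNontrivialZeros.re_pos ρ.2
  have h1 := riemannZetaNontrivialZeros.re_lt_one ρ.2
  unfold weight
  rw [toNat_cast_eq]
  have hre : |(1 - conj (ρ : ℂ)).re| ≤ 1 := by
    simp only [sub_re, one_re, Complex.conj_re]
    rw [abs_le]; constructor <;> linarith
  have him : |(ρ : ℂ).im| ≤ ‖1 - conj (ρ : ℂ)‖ := by
    have := Complex.abs_im_le_norm (1 - conj (ρ : ℂ))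
    simpa [sub_im, one_im, Complex.conj_im] using this
  have hden : 1 + (ρ : ℂ).im ^ 2 ≤ (1 + ‖1 - conj (ρ : ℂ)‖) ^ 2 := by
    have h2 : |(ρ : ℂ).im| ^ 2 ≤ ‖1 - conj (ρ : ℂ)‖ ^ 2 := pow_le_pow_left₀ (abs_nonneg _) him 2
    rw [sq_abs] at h2
    nlinarith [norm_nonneg (1 - conj (ρ : ℂ))]
  calc (riemannZetaZeroOrder (ρ : ℂ) : ℝ) * ((1 + |(1 - conj (ρ : ℂ)).re|) / (1 + ‖1 - conj (ρ : ℂ)‖) ^ 2)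
      ≤ (riemannZetaZeroOrder (ρ : ℂ) : ℝ) * (2 / (1 + (ρ : ℂ).im ^ 2)) := by
        refine mul_le_mul_of_nonneg_left ?_ hm0
        rw [div_le_div_iff₀ (by positivity) (by positivity)]
        nlinarith [abs_nonneg ((1 - conj (ρ : ℂ)).re)]
    _ = 2 * ((riemannZetaZeroOrder (ρ : ℂ) : ℝ) / (1 + (ρ : ℂ).im ^ 2)) := by ring

/-- **Absolute convergence** of `Σ_ρ m(ρ) Re[1 − (1 − 1/ρ)ⁿ]` over the non-trivial zeros of `ζ`.
[cite: Li2004, Theorem 2 and p. 494] -/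
theorem summable_keiperLiTerm (n : ℕ) :
    Summable fun ρ : ZetaZeros.riemannZetaNontrivialZeros ↦
      (riemannZetaZeroOrder (ρ : ℂ) : ℝ) * (1 - (1 - 1 / (ρ : ℂ)) ^ n).re := by
  have h := summable_term_pos (ρ := fun ρ : ZetaZeros.riemannZetaNontrivialZeros ↦ (ρ : ℂ))
    (m := fun ρ ↦ (riemannZetaZeroOrder (ρ : ℂ)).toNat)
    (fun ρ ↦ by have := riemannZetaNontrivialZeros.one_le_order ρ.2; omega)
    (fun ρ ↦ ne_zero_of_mem' ρ) (fun ρ ↦ riemannZetaNontrivialZeros.ne_one ρ.2) summable_weight_zetaZeros n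
  refine h.congr fun ρ ↦ ?_
  rw [toNat_cast_eq]

/-- The Bombieri–Lagarias box `liZeroBox T` is the box `weilZeroIndex T` of the explicit-formula files.
[folklore] -/
private theorem liZeroBox_eq_weilZeroIndex_aux (T : ℝ) : liZeroBox T = weilZeroIndex T := by
  ext ρ
  simp only [liZeroBox, weilZeroIndex, mem_setOf_eq, abs_pos]

/-- **`λ_n` as an absolutely convergent sum over the zeros** (Li 1997 (1.4), Bombieri–Lagarias (1.3)):
for `n ≥ 1`, `λ_n = Σ' ρ, m(ρ) Re[1 − (1 − 1/ρ)ⁿ]`, the `tsum` over the non-trivial zeros of `ζ` with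
multiplicities. [cite: Li1997, eq. (1.4)] -/
theorem keiperLiCoeff_eq_tsum_zeros {n : ℕ} (hn : 1 ≤ n) :
    keiperLiCoeff n = ∑' ρ : ZetaZeros.riemannZetaNontrivialZeros,
      (riemannZetaZeroOrder (ρ : ℂ) : ℝ) * (1 - (1 - 1 / (ρ : ℂ)) ^ n).re := by
  classical
  set f : ZetaZeros.riemannZetaNontrivialZeros → ℝ := fun ρ ↦
    (riemannZetaZeroOrder (ρ : ℂ) : ℝ) * (1 - (1 - 1 / (ρ : ℂ)) ^ n).re with hf
  have hsum : HasSum f (∑' ρ, f ρ) := (summable_keiperLiTerm n).hasSum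
  have hlim := hsum.comp tendsto_weilZeroFinset
  have hbox := (Complex.continuous_re.tendsto _).comp (keiperLiCoeff_eq_zero_sum_holds n hn)
  simp only [Complex.ofReal_re] at hbox
  refine tendsto_nhds_unique (hbox.congr fun T ↦ ?_) hlim
  simp only [Function.comp_apply]
  rw [liZeroBox_eq_weilZeroIndex_aux, ZetaZeroSum.finsum_mem_weilZeroIndex_eq_sum, Complex.re_sum]
  refine Finset.sum_congr rfl fun ρ _ ↦ ?_
  simp only [hf, Complex.mul_re, Complex.intCast_re, Complex.intCast_im, zero_mul, sub_zero]

/-- **`Re ρ ≥ ½` for all non-trivial zeros ⇒ RH**: the zeros come in pairs `ρ, 1 − ρ̄`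
(`riemannZetaNontrivialZeros.one_sub_conj_mem`), so a one-sided inequality is the Riemann hypothesis.
[folklore] -/
private theorem riemannHypothesis_of_forall_half_le_re
    (h : ∀ ρ ∈ ZetaZeros.riemannZetaNontrivialZeros, 1 / 2 ≤ ρ.re) : RiemannHypothesis := by
  intro s hs htriv h1
  have hmem : s ∈ ZetaZeros.riemannZetaNontrivialZeros := by
    refine ⟨hs, ?_⟩
    rintro ⟨k, hk⟩
    exact htriv ⟨k, hk.symm⟩
  have hge := h s hmem
  have hle := h (1 - conj s) (riemannZetaNontrivialZeros.one_sub_conj_mem hmem)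
  simp only [sub_re, one_re, Complex.conj_re] at hle
  linarith

/-- **Li's criterion in the family form** (Bombieri–Lagarias Thm. 1 applied to the non-trivial zeros of `ζ`
with multiplicities): `RH ↔ ∀ n ≥ 1, 0 ≤ Σ' ρ, m(ρ) Re[1 − (1 − 1/ρ)ⁿ]` (`= λ_n`).
[cite: Li2004, Theorem 2 and p. 494; BombieriLagarias1999, Theorem 1] -/
theorem riemannHypothesis_iff_forall_tsum_nonneg :
    RiemannHypothesis ↔ ∀ n : ℕ, 1 ≤ n → 0 ≤ ∑' ρ : ZetaZeros.riemannZetaNontrivialZeros,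
      (riemannZetaZeroOrder (ρ : ℂ) : ℝ) * (1 - (1 - 1 / (ρ : ℂ)) ^ n).re := by
  have hBL := bombieriLagarias1999_theorem1_pos (fun ρ : ZetaZeros.riemannZetaNontrivialZeros ↦ (ρ : ℂ))
    (fun ρ ↦ (riemannZetaZeroOrder (ρ : ℂ)).toNat)
    (fun ρ ↦ by have := riemannZetaNontrivialZeros.one_le_order ρ.2; omega)
    (fun ρ ↦ ne_zero_of_mem' ρ) (fun ρ ↦ riemannZetaNontrivialZeros.ne_one ρ.2) summable_weight_zetaZeros
  have hBL' : (∀ ρ : ZetaZeros.riemannZetaNontrivialZeros, 1 / 2 ≤ (ρ : ℂ).re) ↔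
      ∀ n : ℕ, 1 ≤ n → 0 ≤ ∑' ρ : ZetaZeros.riemannZetaNontrivialZeros,
        (riemannZetaZeroOrder (ρ : ℂ) : ℝ) * (1 - (1 - 1 / (ρ : ℂ)) ^ n).re := by
    rw [hBL]
    refine forall_congr' fun n ↦ forall_congr' fun _ ↦ ?_
    rw [tsum_congr fun ρ ↦ by rw [toNat_cast_eq]]
  rw [← hBL']
  constructor
  · intro hRH ρ
    obtain ⟨hz, hnt⟩ := ρ.2
    have h1 : (ρ : ℂ) ≠ 1 := riemannZetaNontrivialZeros.ne_one ρ.2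
    have := hRH (ρ : ℂ) hz (fun ⟨k, hk⟩ ↦ hnt ⟨k, hk.symm⟩) h1
    rw [this]
  · intro h
    exact riemannHypothesis_of_forall_half_le_re fun ρ hρ ↦ h ⟨ρ, hρ⟩

end Literature.NumberTheory.LFunctions
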